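import Literature.NumberTheory.LFunctions.ConreyIwaniec2002MeanValueDefs
import Mathlib.Analysis.MellinInversion
import Mathlib.Analysis.SpecialFunctions.ImproperIntegrals
import Mathlib.Analysis.SpecialFunctions.Integrability.Basic
import Mathlib.MeasureTheory.Integral.IntegralEqImproper
import Mathlib.Analysis.Fourier.Inversion
import HarnessLib

/-!
# Conrey–Iwaniec (2002), §6: the Mellin transform `M(s)` of the cosine transform `L` of an admissible kernel

B. Conrey, H. Iwaniec, Acta Arith. 103 (2002), §6 [held text `paper:arxiv-math_0111012`, p0015:L128–p0016:L10]:
"Let `M(s)` be the Mellin transform of `L(v)`, `M(s) = ∫₀^∞ L(v)v^{s−1}dv`. Integrating by parts we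
derive by (6.2) `sM(s) ≪ (|s|+1)^{−4}` (6.32). Note that `M(1) = ∫₀^∞ L(v)dv = 2πK(0) = 0` by our
assumption (6.1)."

PROVED HERE (toolkit for the registered stub S5 `stub_offdiagonal` of SKELETON P64, cell
landau-siegel/ls-inputs, line `thm61-cm-convolution`), for `K` with `IsCIKernel K` (the tree's (6.1)–(6.3),
`ConreyIwaniec2002MeanValueDefs.lean`) and `L = ciL K`:
* generic Mellin facts for `f` with `‖f(v)‖ ≤ A(1+v)^{−4}` on `v > 0`: convergence and the bound
  `‖𝓜f(s)‖ ≤ A(1/σ + 1/(4−σ))` on `0 < σ = Re s < 4`; one integration by parts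
  `𝓜f(s) = −s⁻¹ 𝓜f′(s+1)` (`0 < Re s < 3`);
* for `L`: `𝓜L(s) = −(s(s+1)(s+2))⁻¹ 𝓜L‴(s+3)` on `0 < Re s < 1` and the resulting bounds
  `‖M(s)‖ ≤ 2/|s|` (`Re s ≤ 2`), `‖M(s)‖ ≤ 3/(|s||s+1|)` (`Re s ≤ 3/2`), `‖M(s)‖ ≤ 4/(|s||s+1||s+2|)`
  (`Re s ≤ 1/2`) — the typed (6.3) (`|L^{(j)}| ≤ (1+|v|)^{−4}`, `j ≤ 5`) gives three integrations by
  parts on `Re s < 1`, i.e. `|s|⁻³` (not the printed `(|s|+1)⁻⁵`, which would need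
  `∫|L⁽⁵⁾|v^{σ+4} < ∞`);
* `M(1) = 0` (Fourier inversion for `K` at `0`: `∫_ℝ 𝓕K = K(0) = 0`, `𝓕K(ξ) = L(2πξ)`);
* Mellin inversion `L(x) = (1/2π)∫ x^{−(c+it)} M(c+it) dt` for `0 < c ≤ 3/2`.

## References
* [ConreyIwaniec2002] B. Conrey, H. Iwaniec, Acta Arith. 103 (2002) 259–312: §6 (6.1)–(6.3), (6.32)–(6.34).
* [Titchmarsh1948] E. C. Titchmarsh, *Introduction to the theory of Fourier integrals*, §1.29 (Mellin inversion).
-/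

noncomputable section

open Complex MeasureTheory Set Filter Real
open scoped Topology FourierTransform

namespace Literature.NumberTheory.LFunctions

namespace ConreyIwaniec2002

namespace KernelMellin

/-! ### Integrability of `x^r (1+x)^{-4}` on `(0,∞)` -/

/-- `∫₀^∞ x^r (1+x)^{−4} dx` converges for `−1 < r < 3` and is `≤ 1/(r+1) + 1/(3−r)`.
[cite: Titchmarsh1948, §1.29] -/
theorem integrableOn_rpow_mul_inv_quartic {r : ℝ} (hr1 : -1 < r) (hr3 : r < 3) :
    IntegrableOn (fun x : ℝ => x ^ r * ((1 + x) ^ 4)⁻¹) (Ioi 0) ∧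
      ∫ x in Ioi (0 : ℝ), x ^ r * ((1 + x) ^ 4)⁻¹ ≤ 1 / (r + 1) + 1 / (3 - r) := by
  -- split at `1`
  have hmeas : ∀ x : ℝ, 0 < x → 0 ≤ x ^ r * ((1 + x) ^ 4)⁻¹ := fun x hx => by positivity
  have hcont : ContinuousOn (fun x : ℝ => x ^ r * ((1 + x) ^ 4)⁻¹) (Ioi 0) := by
    intro x hx
    have hx0 : (0:ℝ) < x := hx
    refine ContinuousAt.continuousWithinAt ?_
    refine (Real.continuousAt_rpow_const _ _ (Or.inl hx0.ne')).mul ?_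
    refine ContinuousAt.inv₀ (by fun_prop) (by positivity)
  -- on `(0,1]`: `≤ x^r`
  have h1 : IntegrableOn (fun x : ℝ => x ^ r * ((1 + x) ^ 4)⁻¹) (Ioc 0 1) := by
    have hr : IntegrableOn (fun x : ℝ => x ^ r) (Ioc 0 1) := by
      have := (intervalIntegral.intervalIntegrable_rpow' hr1 (a := 0) (b := 1))
      rw [intervalIntegrable_iff_integrableOn_Ioc_of_le zero_le_one] at this
      exact this
    refine Integrable.mono' hr ?_ ?_
    · exact (hcont.mono Ioc_subset_Ioi_self).aestronglyMeasurable measurableSet_Ioc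
    · refine (ae_restrict_iff' measurableSet_Ioc).mpr (Eventually.of_forall fun x hx => ?_)
      rw [Real.norm_of_nonneg (hmeas x hx.1)]
      refine mul_le_of_le_one_right (Real.rpow_nonneg hx.1.le _) ?_
      refine inv_le_one_of_one_le₀ (one_le_pow₀ (by linarith [hx.1]))
  -- on `(1,∞)`: `≤ x^{r-4}`
  have h2 : IntegrableOn (fun x : ℝ => x ^ r * ((1 + x) ^ 4)⁻¹) (Ioi 1) := by
    have hr : IntegrableOn (fun x : ℝ => x ^ (r - 4)) (Ioi 1) :=
      integrableOn_Ioi_rpow_of_lt (by linarith) zero_lt_one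
    refine Integrable.mono' hr ?_ ?_
    · exact (hcont.mono (Ioi_subset_Ioi zero_le_one)).aestronglyMeasurable measurableSet_Ioi
    · refine (ae_restrict_iff' measurableSet_Ioi).mpr (Eventually.of_forall fun x hx => ?_)
      have hx1 : (1:ℝ) < x := hx
      have hx0 : 0 < x := by linarith
      rw [Real.norm_of_nonneg (hmeas x hx0), Real.rpow_sub hx0, div_eq_mul_inv]
      refine mul_le_mul_of_nonneg_left ?_ (Real.rpow_nonneg hx0.le _)
      rw [show (4:ℝ) = ((4:ℕ):ℝ) by norm_num, Real.rpow_natCast]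
      exact inv_anti₀ (by positivity) (pow_le_pow_left₀ hx0.le (by linarith) 4)
  have hunion : Ioi (0:ℝ) = Ioc 0 1 ∪ Ioi 1 := (Ioc_union_Ioi_eq_Ioi zero_le_one).symm
  have hint : IntegrableOn (fun x : ℝ => x ^ r * ((1 + x) ^ 4)⁻¹) (Ioi 0) := by
    rw [hunion]; exact h1.union h2
  refine ⟨hint, ?_⟩
  -- the bound
  have e1 : ∫ x in Ioc (0:ℝ) 1, x ^ r * ((1 + x) ^ 4)⁻¹ ≤ 1 / (r + 1) := by
    calc ∫ x in Ioc (0:ℝ) 1, x ^ r * ((1 + x) ^ 4)⁻¹ ≤ ∫ x in Ioc (0:ℝ) 1, x ^ r := by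
          refine setIntegral_mono_on h1 ?_ measurableSet_Ioc fun x hx => ?_
          · have := (intervalIntegral.intervalIntegrable_rpow' hr1 (a := 0) (b := 1))
            rwa [intervalIntegrable_iff_integrableOn_Ioc_of_le zero_le_one] at this
          · refine mul_le_of_le_one_right (Real.rpow_nonneg hx.1.le _) ?_
            exact inv_le_one_of_one_le₀ (one_le_pow₀ (by linarith [hx.1]))
      _ = ∫ x in (0:ℝ)..1, x ^ r := (intervalIntegral.integral_of_le zero_le_one).symm
      _ = 1 / (r + 1) := by
          rw [integral_rpow (Or.inl hr1)]
          simp [Real.zero_rpow (by linarith : r + 1 ≠ 0)]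
  have e2 : ∫ x in Ioi (1:ℝ), x ^ r * ((1 + x) ^ 4)⁻¹ ≤ 1 / (3 - r) := by
    calc ∫ x in Ioi (1:ℝ), x ^ r * ((1 + x) ^ 4)⁻¹ ≤ ∫ x in Ioi (1:ℝ), x ^ (r - 4) := by
          refine setIntegral_mono_on h2 (integrableOn_Ioi_rpow_of_lt (by linarith) zero_lt_one)
            measurableSet_Ioi fun x hx => ?_
          have hx1 : (1:ℝ) < x := hx
          have hx0 : 0 < x := by linarith
          rw [Real.rpow_sub hx0, div_eq_mul_inv]
          refine mul_le_mul_of_nonneg_left ?_ (Real.rpow_nonneg hx0.le _)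
          rw [show (4:ℝ) = ((4:ℕ):ℝ) by norm_num, Real.rpow_natCast]
          exact inv_anti₀ (by positivity) (pow_le_pow_left₀ hx0.le (by linarith) 4)
      _ = 1 / (3 - r) := by
          rw [integral_Ioi_rpow_of_lt (by linarith) zero_lt_one]
          rw [Real.one_rpow]
          have : r - 4 + 1 = -(3 - r) := by ring
          rw [this, neg_div, div_neg, neg_neg]
  calc ∫ x in Ioi (0:ℝ), x ^ r * ((1 + x) ^ 4)⁻¹
      = (∫ x in Ioc (0:ℝ) 1, x ^ r * ((1 + x) ^ 4)⁻¹) + ∫ x in Ioi (1:ℝ), x ^ r * ((1 + x) ^ 4)⁻¹ := by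
        rw [hunion]
        exact setIntegral_union (Set.disjoint_left.mpr fun x hx hx' => by
          exact absurd hx' (not_lt.mpr hx.2)) measurableSet_Ioi h1 h2
    _ ≤ 1 / (r + 1) + 1 / (3 - r) := add_le_add e1 e2

/-! ### Mellin transforms of functions with the decay `(1+v)^{-4}` -/

/-- Under the quartic decay `‖f(v)‖ ≤ A(1+v)^{−4}` the Mellin integrand is dominated by
`A·v^{σ−1}(1+v)^{−4}`. [cite: Titchmarsh1948, §1.29] -/
theorem norm_cpow_mul_le {f : ℝ → ℂ} {A : ℝ} (hb : ∀ v : ℝ, 0 < v → ‖f v‖ ≤ A * ((1 + v) ^ 4)⁻¹)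
    (s : ℂ) {v : ℝ} (hv : 0 < v) :
    ‖(v : ℂ) ^ (s - 1) • f v‖ ≤ A * (v ^ (s.re - 1) * ((1 + v) ^ 4)⁻¹) := by
  rw [norm_smul, Complex.norm_cpow_eq_rpow_re_of_pos hv, Complex.sub_re, Complex.one_re]
  calc v ^ (s.re - 1) * ‖f v‖ ≤ v ^ (s.re - 1) * (A * ((1 + v) ^ 4)⁻¹) :=
        mul_le_mul_of_nonneg_left (hb v hv) (Real.rpow_nonneg hv.le _)
    _ = A * (v ^ (s.re - 1) * ((1 + v) ^ 4)⁻¹) := by ring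

/-- Mellin convergence on `0 < Re s < 4` under the quartic decay. [cite: Titchmarsh1948, §1.29] -/
theorem mellinConvergent_of_quartic {f : ℝ → ℂ} {A : ℝ} (hc : ContinuousOn f (Ioi 0))
    (hb : ∀ v : ℝ, 0 < v → ‖f v‖ ≤ A * ((1 + v) ^ 4)⁻¹) {s : ℂ} (h0 : 0 < s.re) (h4 : s.re < 4) :
    MellinConvergent f s := by
  unfold MellinConvergent
  have hI := (integrableOn_rpow_mul_inv_quartic (r := s.re - 1) (by linarith) (by linarith)).1
  refine Integrable.mono' (hI.const_mul A) ?_ ?_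
  · refine ContinuousOn.aestronglyMeasurable (fun v hv => ?_) measurableSet_Ioi
    have hv0 : (0:ℝ) < v := hv
    exact ((Complex.continuousAt_ofReal_cpow_const v (s - 1) (Or.inr hv0.ne')).smul
      (hc.continuousAt (Ioi_mem_nhds hv0))).continuousWithinAt
  · refine (ae_restrict_iff' measurableSet_Ioi).mpr (Eventually.of_forall fun v hv => ?_)
    exact norm_cpow_mul_le hb s hv

/-- The Mellin bound `‖𝓜f(s)‖ ≤ A(1/σ + 1/(4−σ))` for `0 < σ = Re s < 4` under the quartic decay.
[cite: Titchmarsh1948, §1.29] -/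
theorem norm_mellin_le_of_quartic {f : ℝ → ℂ} {A : ℝ}
    (hb : ∀ v : ℝ, 0 < v → ‖f v‖ ≤ A * ((1 + v) ^ 4)⁻¹) {s : ℂ} (h0 : 0 < s.re) (h4 : s.re < 4) :
    ‖mellin f s‖ ≤ A * (1 / s.re + 1 / (4 - s.re)) := by
  have hI := integrableOn_rpow_mul_inv_quartic (r := s.re - 1) (by linarith) (by linarith)
  have hA : 0 ≤ A := by
    have := hb 1 one_pos
    have h2 : (0:ℝ) < ((1 + (1:ℝ)) ^ 4)⁻¹ := by norm_num
    nlinarith [norm_nonneg (f 1)]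
  unfold mellin
  calc ‖∫ v in Ioi (0:ℝ), (v : ℂ) ^ (s - 1) • f v‖
      ≤ ∫ v in Ioi (0:ℝ), A * (v ^ (s.re - 1) * ((1 + v) ^ 4)⁻¹) := by
        refine norm_integral_le_of_norm_le (hI.1.const_mul A) ?_
        exact (ae_restrict_iff' measurableSet_Ioi).mpr (Eventually.of_forall fun v hv =>
          norm_cpow_mul_le hb s hv)
    _ = A * ∫ v in Ioi (0:ℝ), v ^ (s.re - 1) * ((1 + v) ^ 4)⁻¹ := integral_const_mul _ _
    _ ≤ A * (1 / (s.re - 1 + 1) + 1 / (3 - (s.re - 1))) := mul_le_mul_of_nonneg_left hI.2 hA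
    _ = A * (1 / s.re + 1 / (4 - s.re)) := by ring_nf

/-- **One integration by parts for the Mellin transform**: if `f ∈ C¹(0,∞)` and `f`, `f′` are
continuous on `(0,∞)` with `‖f‖, ‖f′‖ ≤ A(1+v)^{−4}`, then `𝓜f(s) = −s⁻¹·𝓜f′(s+1)` for
`0 < Re s < 3` (boundary terms `f(v)v^s/s → 0` at `0⁺` and `∞`).
[cite: ConreyIwaniec2002, §6 (6.32)] -/
theorem mellin_eq_neg_inv_mul_mellin_deriv {f f' : ℝ → ℂ} {A : ℝ}
    (hf : ∀ v ∈ Ioi (0:ℝ), HasDerivAt f (f' v) v)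
    (hcf' : ContinuousOn f' (Ioi 0))
    (hbf : ∀ v : ℝ, 0 < v → ‖f v‖ ≤ A * ((1 + v) ^ 4)⁻¹)
    (hbf' : ∀ v : ℝ, 0 < v → ‖f' v‖ ≤ A * ((1 + v) ^ 4)⁻¹)
    {s : ℂ} (h0 : 0 < s.re) (h3 : s.re < 3) :
    mellin f s = -s⁻¹ * mellin f' (s + 1) := by
  have hs0 : s ≠ 0 := by rintro rfl; simp at h0
  have hcf : ContinuousOn f (Ioi 0) := fun v hv => (hf v hv).continuousAt.continuousWithinAt
  have hA : 0 ≤ A := by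
    have := hbf 1 one_pos
    have h2 : (0:ℝ) < ((1 + (1:ℝ)) ^ 4)⁻¹ := by norm_num
    nlinarith [norm_nonneg (f 1)]
  -- the primitive `g(v) = v^s/s` of `v^{s-1}`
  set g : ℝ → ℂ := fun v => (v : ℂ) ^ ((s - 1) + 1) / ((s - 1) + 1) with hg
  have hg' : ∀ v ∈ Ioi (0:ℝ), HasDerivAt g ((v : ℂ) ^ (s - 1)) v := fun v hv =>
    hasDerivAt_ofReal_cpow_const' (ne_of_gt hv) (by
      intro h; apply hs0; linear_combination h)
  have hg_eq : ∀ v : ℝ, g v = (v : ℂ) ^ s / s := fun v => by simp [hg]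
  have hnorm_g : ∀ v : ℝ, 0 < v → ‖g v‖ = v ^ s.re / ‖s‖ := fun v hv => by
    rw [hg_eq, norm_div, Complex.norm_cpow_eq_rpow_re_of_pos hv]
  -- integrability of `f · v^{s-1}` and of `f' · g`
  have hI1 := integrableOn_rpow_mul_inv_quartic (r := s.re - 1) (by linarith) (by linarith)
  have hI2 := integrableOn_rpow_mul_inv_quartic (r := s.re) (by linarith) h3
  have huv' : IntegrableOn (f * fun v : ℝ => (v : ℂ) ^ (s - 1)) (Ioi 0) := by
    have := mellinConvergent_of_quartic hcf hbf h0 (by linarith)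
    unfold MellinConvergent at this
    refine this.congr_fun (fun v _ => ?_) measurableSet_Ioi
    simp [smul_eq_mul, mul_comm]
  have hu'v : IntegrableOn (f' * g) (Ioi 0) := by
    refine Integrable.mono' (hI2.1.const_mul (A / ‖s‖)) ?_ ?_
    · refine ContinuousOn.aestronglyMeasurable (fun v hv => ?_) measurableSet_Ioi
      exact ((hcf'.continuousAt (Ioi_mem_nhds hv)).mul
        (hg' v hv).continuousAt).continuousWithinAt
    · refine (ae_restrict_iff' measurableSet_Ioi).mpr (Eventually.of_forall fun v hv => ?_)
      have hv0 : (0:ℝ) < v := hv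
      rw [Pi.mul_apply, norm_mul, hnorm_g v hv0]
      calc ‖f' v‖ * (v ^ s.re / ‖s‖) ≤ A * ((1 + v) ^ 4)⁻¹ * (v ^ s.re / ‖s‖) :=
            mul_le_mul_of_nonneg_right (hbf' v hv0) (by positivity)
        _ = A / ‖s‖ * (v ^ s.re * ((1 + v) ^ 4)⁻¹) := by ring
  -- boundary terms
  have h_zero : Tendsto (f * g) (𝓝[>] 0) (𝓝 0) := by
    rw [tendsto_zero_iff_norm_tendsto_zero]
    have hbound : ∀ v ∈ Ioi (0:ℝ), ‖(f * g) v‖ ≤ A / ‖s‖ * v ^ s.re := fun v hv => by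
      have hv0 : (0:ℝ) < v := hv
      rw [Pi.mul_apply, norm_mul, hnorm_g v hv0]
      calc ‖f v‖ * (v ^ s.re / ‖s‖) ≤ A * ((1 + v) ^ 4)⁻¹ * (v ^ s.re / ‖s‖) :=
            mul_le_mul_of_nonneg_right (hbf v hv0) (by positivity)
        _ ≤ A * 1 * (v ^ s.re / ‖s‖) := by
            gcongr
            exact inv_le_one_of_one_le₀ (one_le_pow₀ (by linarith))
        _ = A / ‖s‖ * v ^ s.re := by ring
    have hlim : Tendsto (fun v : ℝ => A / ‖s‖ * v ^ s.re) (𝓝[>] 0) (𝓝 0) := by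
      have : Tendsto (fun v : ℝ => v ^ s.re) (𝓝[>] 0) (𝓝 0) := by
        have h := (Real.continuousAt_rpow_const 0 s.re (Or.inr h0.le)).tendsto
        rw [Real.zero_rpow h0.ne'] at h
        exact h.mono_left nhdsWithin_le_nhds
      simpa using this.const_mul (A / ‖s‖)
    exact squeeze_zero_norm' (eventually_nhdsWithin_of_forall fun v hv => by
      simpa using hbound v hv) hlim
  have h_infty : Tendsto (f * g) atTop (𝓝 0) := by
    rw [tendsto_zero_iff_norm_tendsto_zero]
    have hbound : ∀ v : ℝ, 1 ≤ v → ‖(f * g) v‖ ≤ A / ‖s‖ * v ^ (s.re - 4) := fun v hv => by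
      have hv0 : (0:ℝ) < v := by linarith
      rw [Pi.mul_apply, norm_mul, hnorm_g v hv0]
      calc ‖f v‖ * (v ^ s.re / ‖s‖) ≤ A * ((1 + v) ^ 4)⁻¹ * (v ^ s.re / ‖s‖) :=
            mul_le_mul_of_nonneg_right (hbf v hv0) (by positivity)
        _ ≤ A * (v ^ (4:ℝ))⁻¹ * (v ^ s.re / ‖s‖) := by
            gcongr
            rw [show (4:ℝ) = ((4:ℕ):ℝ) by norm_num, Real.rpow_natCast]
            exact pow_le_pow_left₀ hv0.le (by linarith) 4
        _ = A / ‖s‖ * v ^ (s.re - 4) := by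
            rw [Real.rpow_sub hv0]; ring
    have hlim : Tendsto (fun v : ℝ => A / ‖s‖ * v ^ (s.re - 4)) atTop (𝓝 0) := by
      have : Tendsto (fun v : ℝ => v ^ (s.re - 4)) atTop (𝓝 0) := by
        rw [show s.re - 4 = -(4 - s.re) by ring]
        exact tendsto_rpow_neg_atTop (by linarith)
      simpa using this.const_mul (A / ‖s‖)
    exact squeeze_zero_norm' (by
      filter_upwards [eventually_ge_atTop 1] with v hv
      simpa using hbound v hv) hlim
  -- integrate by parts
  have hibp := integral_Ioi_mul_deriv_eq_deriv_mul hf hg' huv' hu'v h_zero h_infty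
  -- rewrite both Mellin transforms
  have hm1 : mellin f s = ∫ v in Ioi (0:ℝ), f v * (v : ℂ) ^ (s - 1) := by
    unfold mellin; exact setIntegral_congr_fun measurableSet_Ioi fun v _ => by
      simp [smul_eq_mul, mul_comm]
  have hm2 : mellin f' (s + 1) = ∫ v in Ioi (0:ℝ), f' v * (v : ℂ) ^ s := by
    unfold mellin; exact setIntegral_congr_fun measurableSet_Ioi fun v _ => by
      simp [smul_eq_mul, mul_comm]
  have hm3 : ∫ v in Ioi (0:ℝ), f' v * g v = s⁻¹ * ∫ v in Ioi (0:ℝ), f' v * (v : ℂ) ^ s := by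
    rw [← integral_const_mul]
    exact setIntegral_congr_fun measurableSet_Ioi fun v _ => by rw [hg_eq]; field_simp
  rw [hm1, hibp, hm2, hm3]
  simp

/-! ### Application to `L = ciL K` -/

section Kernel

variable {K : ℝ → ℝ} (hK : IsCIKernel K)
include hK

/-- The derivative bounds (6.3) on `(0,∞)` in the form `‖L^{(j)}(v)‖ ≤ 1·(1+v)^{-4}`.
[cite: ConreyIwaniec2002, §6 (6.3)] -/
theorem norm_iteratedDeriv_ciL_le {j : ℕ} (hj : j ≤ 5) {v : ℝ} (hv : 0 < v) :
    ‖((iteratedDeriv j (ciL K) v : ℝ) : ℂ)‖ ≤ 1 * ((1 + v) ^ 4)⁻¹ := by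
  rw [Complex.norm_real, Real.norm_eq_abs, one_mul]
  have h := hK.2.2.2.2.2 j hj v
  rwa [abs_of_pos hv] at h

/-- `L^{(j)}` has derivative `L^{(j+1)}` (`j < 5`). [cite: ConreyIwaniec2002, §6 (6.3)] -/
theorem hasDerivAt_iteratedDeriv_ciL {j : ℕ} (hj : j < 5) (v : ℝ) :
    HasDerivAt (fun y : ℝ => ((iteratedDeriv j (ciL K) y : ℝ) : ℂ))
      ((iteratedDeriv (j + 1) (ciL K) v : ℝ) : ℂ) v := by
  have hd : Differentiable ℝ (iteratedDeriv j (ciL K)) :=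
    hK.2.2.2.2.1.differentiable_iteratedDeriv j (by exact_mod_cast hj)
  have h1 : HasDerivAt (iteratedDeriv j (ciL K)) (iteratedDeriv (j + 1) (ciL K) v) v := by
    rw [iteratedDeriv_succ]
    exact (hd v).hasDerivAt
  exact h1.ofReal_comp

/-- `L^{(j)}` is continuous (`j ≤ 5`). [cite: ConreyIwaniec2002, §6 (6.3)] -/
theorem continuous_iteratedDeriv_ciL {j : ℕ} (hj : j ≤ 5) :
    Continuous (fun y : ℝ => ((iteratedDeriv j (ciL K) y : ℝ) : ℂ)) :=
  continuous_ofReal.comp (hK.2.2.2.2.1.continuous_iteratedDeriv j (by exact_mod_cast hj))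

/-- One integration by parts: `M(s) = −s⁻¹ 𝓜L′(s+1)` on `0 < Re s < 3`.
[cite: ConreyIwaniec2002, §6 (6.32)] -/
theorem mellin_ciL_eq_one (s : ℂ) (h0 : 0 < s.re) (h3 : s.re < 3) :
    mellin (fun v : ℝ => ((ciL K v : ℝ) : ℂ)) s =
      -s⁻¹ * mellin (fun v : ℝ => ((iteratedDeriv 1 (ciL K) v : ℝ) : ℂ)) (s + 1) := by
  have h := mellin_eq_neg_inv_mul_mellin_deriv (A := 1)
    (f := fun v : ℝ => ((iteratedDeriv 0 (ciL K) v : ℝ) : ℂ))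
    (f' := fun v : ℝ => ((iteratedDeriv 1 (ciL K) v : ℝ) : ℂ))
    (fun v _ => hasDerivAt_iteratedDeriv_ciL hK (by norm_num) v)
    (continuous_iteratedDeriv_ciL hK (by norm_num)).continuousOn
    (fun v hv => norm_iteratedDeriv_ciL_le hK (by norm_num) hv)
    (fun v hv => norm_iteratedDeriv_ciL_le hK (by norm_num) hv) h0 h3
  simpa only [iteratedDeriv_zero] using h

/-- Two integrations by parts: `M(s) = (s(s+1))⁻¹ 𝓜L″(s+2)` on `0 < Re s < 2`.
[cite: ConreyIwaniec2002, §6 (6.32)] -/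
theorem mellin_ciL_eq_two (s : ℂ) (h0 : 0 < s.re) (h2 : s.re < 2) :
    mellin (fun v : ℝ => ((ciL K v : ℝ) : ℂ)) s =
      s⁻¹ * (s + 1)⁻¹ * mellin (fun v : ℝ => ((iteratedDeriv 2 (ciL K) v : ℝ) : ℂ)) (s + 2) := by
  rw [mellin_ciL_eq_one hK s h0 (by linarith)]
  have h := mellin_eq_neg_inv_mul_mellin_deriv (A := 1)
    (f := fun v : ℝ => ((iteratedDeriv 1 (ciL K) v : ℝ) : ℂ))
    (f' := fun v : ℝ => ((iteratedDeriv 2 (ciL K) v : ℝ) : ℂ))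
    (fun v _ => hasDerivAt_iteratedDeriv_ciL hK (by norm_num) v)
    (continuous_iteratedDeriv_ciL hK (by norm_num)).continuousOn
    (fun v hv => norm_iteratedDeriv_ciL_le hK (by norm_num) hv)
    (fun v hv => norm_iteratedDeriv_ciL_le hK (by norm_num) hv) (s := s + 1)
    (by simp; linarith) (by simp; linarith)
  rw [h, show s + 1 + 1 = s + 2 by ring]
  ring

/-- Three integrations by parts: `M(s) = −(s(s+1)(s+2))⁻¹ 𝓜L‴(s+3)` on `0 < Re s < 1`.
[cite: ConreyIwaniec2002, §6 (6.32)] -/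
theorem mellin_ciL_eq_three (s : ℂ) (h0 : 0 < s.re) (h1 : s.re < 1) :
    mellin (fun v : ℝ => ((ciL K v : ℝ) : ℂ)) s =
      -(s⁻¹ * (s + 1)⁻¹ * (s + 2)⁻¹) *
        mellin (fun v : ℝ => ((iteratedDeriv 3 (ciL K) v : ℝ) : ℂ)) (s + 3) := by
  rw [mellin_ciL_eq_two hK s h0 (by linarith)]
  have h := mellin_eq_neg_inv_mul_mellin_deriv (A := 1)
    (f := fun v : ℝ => ((iteratedDeriv 2 (ciL K) v : ℝ) : ℂ))
    (f' := fun v : ℝ => ((iteratedDeriv 3 (ciL K) v : ℝ) : ℂ))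
    (fun v _ => hasDerivAt_iteratedDeriv_ciL hK (by norm_num) v)
    (continuous_iteratedDeriv_ciL hK (by norm_num)).continuousOn
    (fun v hv => norm_iteratedDeriv_ciL_le hK (by norm_num) hv)
    (fun v hv => norm_iteratedDeriv_ciL_le hK (by norm_num) hv) (s := s + 2)
    (by simp; linarith) (by simp; linarith)
  rw [h, show s + 2 + 1 = s + 3 by ring]
  ring

/-- Bound for the Mellin transform of `L^{(j)}`: `‖𝓜L^{(j)}(w)‖ ≤ 1/Re w + 1/(4 − Re w)`.
[cite: ConreyIwaniec2002, §6 (6.32)] -/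
theorem norm_mellin_iteratedDeriv_ciL_le {j : ℕ} (hj : j ≤ 5) {w : ℂ} (h0 : 0 < w.re)
    (h4 : w.re < 4) :
    ‖mellin (fun v : ℝ => ((iteratedDeriv j (ciL K) v : ℝ) : ℂ)) w‖ ≤ 1 / w.re + 1 / (4 - w.re) := by
  have h := norm_mellin_le_of_quartic (A := 1)
    (fun v hv => norm_iteratedDeriv_ciL_le hK hj hv) h0 h4
  simpa using h

/-- `‖M(s)‖ ≤ 2/|s|` for `0 < Re s ≤ 2`. [cite: ConreyIwaniec2002, §6 (6.32)] -/
theorem norm_mellin_ciL_le_one {s : ℂ} (h0 : 0 < s.re) (h2 : s.re ≤ 2) :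
    ‖mellin (fun v : ℝ => ((ciL K v : ℝ) : ℂ)) s‖ ≤ 2 / ‖s‖ := by
  rw [mellin_ciL_eq_one hK s h0 (by linarith), norm_mul, norm_neg, norm_inv]
  have hb := norm_mellin_iteratedDeriv_ciL_le hK (j := 1) (by norm_num) (w := s + 1)
    (by simp; linarith) (by simp; linarith)
  simp only [Complex.add_re, Complex.one_re] at hb
  have hs : 0 < ‖s‖ := norm_pos_iff.mpr (by rintro rfl; simp at h0)
  have h1 : 1 / (s.re + 1) ≤ 1 := by
    rw [div_le_one (by linarith)]; linarith
  have h2' : 1 / (4 - (s.re + 1)) ≤ 1 := by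
    rw [div_le_one (by linarith)]; linarith
  calc ‖s‖⁻¹ * ‖mellin (fun v : ℝ => ((iteratedDeriv 1 (ciL K) v : ℝ) : ℂ)) (s + 1)‖
      ≤ ‖s‖⁻¹ * (1 / (s.re + 1) + 1 / (4 - (s.re + 1))) :=
        mul_le_mul_of_nonneg_left hb (inv_nonneg.mpr hs.le)
    _ ≤ ‖s‖⁻¹ * 2 := by gcongr; linarith
    _ = 2 / ‖s‖ := by rw [inv_mul_eq_div]

/-- `‖M(s)‖ ≤ 3/(|s||s+1|)` for `0 < Re s ≤ 3/2`. [cite: ConreyIwaniec2002, §6 (6.32)] -/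
theorem norm_mellin_ciL_le_two {s : ℂ} (h0 : 0 < s.re) (h2 : s.re ≤ 3 / 2) :
    ‖mellin (fun v : ℝ => ((ciL K v : ℝ) : ℂ)) s‖ ≤ 3 / (‖s‖ * ‖s + 1‖) := by
  rw [mellin_ciL_eq_two hK s h0 (by linarith), norm_mul, norm_mul, norm_inv, norm_inv]
  have hb := norm_mellin_iteratedDeriv_ciL_le hK (j := 2) (by norm_num) (w := s + 2)
    (by simp; linarith) (by simp; linarith)
  have hre : (s + 2).re = s.re + 2 := by simp
  rw [hre] at hb
  have hs : 0 < ‖s‖ := norm_pos_iff.mpr (by rintro rfl; simp at h0)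
  have hs1 : 0 < ‖s + 1‖ := norm_pos_iff.mpr (by
    intro h; have := congrArg Complex.re h; simp at this; linarith)
  have h1 : 1 / (s.re + 2) ≤ 1 := by rw [div_le_one (by linarith)]; linarith
  have h2' : 1 / (4 - (s.re + 2)) ≤ 2 := by rw [div_le_iff₀ (by linarith)]; linarith
  calc ‖s‖⁻¹ * ‖s + 1‖⁻¹ * ‖mellin (fun v : ℝ => ((iteratedDeriv 2 (ciL K) v : ℝ) : ℂ)) (s + 2)‖
      ≤ ‖s‖⁻¹ * ‖s + 1‖⁻¹ * (1 / (s.re + 2) + 1 / (4 - (s.re + 2))) :=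
        mul_le_mul_of_nonneg_left hb (by positivity)
    _ ≤ ‖s‖⁻¹ * ‖s + 1‖⁻¹ * 3 := by gcongr; linarith
    _ = 3 / (‖s‖ * ‖s + 1‖) := by rw [← mul_inv, inv_mul_eq_div]

/-- `‖M(s)‖ ≤ 3/(|s||s+1||s+2|)` for `0 < Re s ≤ 1/2` (three integrations by parts; this is the
decay available from the typed (6.3)). [cite: ConreyIwaniec2002, §6 (6.32)] -/
theorem norm_mellin_ciL_le_three {s : ℂ} (h0 : 0 < s.re) (h1 : s.re ≤ 1 / 2) :
    ‖mellin (fun v : ℝ => ((ciL K v : ℝ) : ℂ)) s‖ ≤ 3 / (‖s‖ * ‖s + 1‖ * ‖s + 2‖) := by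
  rw [mellin_ciL_eq_three hK s h0 (by linarith), norm_mul, norm_neg, norm_mul, norm_mul,
    norm_inv, norm_inv, norm_inv]
  have hb := norm_mellin_iteratedDeriv_ciL_le hK (j := 3) (by norm_num) (w := s + 3)
    (by simp; linarith) (by simp; linarith)
  have hre : (s + 3).re = s.re + 3 := by simp
  rw [hre] at hb
  have hs : 0 < ‖s‖ := norm_pos_iff.mpr (by rintro rfl; simp at h0)
  have hs1 : 0 < ‖s + 1‖ := norm_pos_iff.mpr (by
    intro h; have := congrArg Complex.re h; simp at this; linarith)
  have hs2 : 0 < ‖s + 2‖ := norm_pos_iff.mpr (by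
    intro h; have := congrArg Complex.re h; simp at this; linarith)
  have h1' : 1 / (s.re + 3) ≤ 1 := by rw [div_le_one (by linarith)]; linarith
  have h2' : 1 / (4 - (s.re + 3)) ≤ 2 := by rw [div_le_iff₀ (by linarith)]; linarith
  calc ‖s‖⁻¹ * ‖s + 1‖⁻¹ * ‖s + 2‖⁻¹ *
        ‖mellin (fun v : ℝ => ((iteratedDeriv 3 (ciL K) v : ℝ) : ℂ)) (s + 3)‖
      ≤ ‖s‖⁻¹ * ‖s + 1‖⁻¹ * ‖s + 2‖⁻¹ * (1 / (s.re + 3) + 1 / (4 - (s.re + 3))) :=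
        mul_le_mul_of_nonneg_left hb (by positivity)
    _ ≤ ‖s‖⁻¹ * ‖s + 1‖⁻¹ * ‖s + 2‖⁻¹ * 3 := by gcongr; linarith
    _ = 3 / (‖s‖ * ‖s + 1‖ * ‖s + 2‖) := by rw [← mul_inv, ← mul_inv, inv_mul_eq_div]

end Kernel

/-! ### `M(1) = 0`, holomorphy, Mellin inversion -/

section Kernel2

variable {K : ℝ → ℝ} (hK : IsCIKernel K)
include hK

/-- `|L(v)| ≤ (1+|v|)^{-4}` on all of `ℝ`. [cite: ConreyIwaniec2002, §6 (6.3)] -/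
theorem abs_ciL_le (v : ℝ) : |ciL K v| ≤ ((1 + |v|) ^ 4)⁻¹ := by
  simpa using hK.2.2.2.2.2 0 (by norm_num) v

omit hK in
/-- The cosine transform is even. [cite: ConreyIwaniec2002, §6 (6.2)] -/
theorem ciL_even (v : ℝ) : ciL K (-v) = ciL K v := by
  simp [ciL, mul_neg, Real.cos_neg]

/-- **The Fourier transform of the (even, compactly supported, continuous) kernel is its cosine
transform**: `𝓕K(ξ) = L(2πξ)`. [cite: ConreyIwaniec2002, §6 (6.2)] -/
theorem fourier_kernel_eq (ξ : ℝ) :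
    𝓕 (fun u : ℝ => (K u : ℂ)) ξ = ((ciL K (2 * Real.pi * ξ) : ℝ) : ℂ) := by
  have hKc : Continuous K := hK.1
  have hKi : Integrable (fun u : ℝ => (K u : ℂ)) :=
    (hKc.integrable_of_hasCompactSupport hK.2.2.2.1).ofReal
  -- integrability of the two oscillatory integrands (continuous, compact support)
  have hint : ∀ η : ℝ, Integrable (fun v : ℝ =>
      Complex.exp (↑(-2 * Real.pi * v * η) * I) • ((K v : ℝ) : ℂ)) := by
    intro η
    have hc1 : Continuous fun v : ℝ => Complex.exp (↑(-2 * Real.pi * v * η) * I) := by fun_prop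
    have hc2 : Continuous fun v : ℝ => ((K v : ℝ) : ℂ) := continuous_ofReal.comp hKc
    have hs2 : HasCompactSupport fun v : ℝ => ((K v : ℝ) : ℂ) :=
      hK.2.2.2.1.comp_left Complex.ofReal_zero
    have hs : HasCompactSupport fun v : ℝ => Complex.exp (↑(-2 * Real.pi * v * η) * I) * ((K v : ℝ) : ℂ) :=
      hs2.mul_left
    exact (Continuous.integrable_of_hasCompactSupport (hc1.mul hc2) hs).congr
      (Eventually.of_forall fun v => by simp only [Pi.mul_apply, smul_eq_mul])
  -- `𝓕K(ξ) = 𝓕K(-ξ)` by evenness (substitute `v ↦ -v`)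
  have hsym : 𝓕 (fun u : ℝ => (K u : ℂ)) ξ = 𝓕 (fun u : ℝ => (K u : ℂ)) (-ξ) := by
    rw [Real.fourier_real_eq_integral_exp_smul, Real.fourier_real_eq_integral_exp_smul]
    have h := integral_neg_eq_self
      (fun v : ℝ => Complex.exp (↑(-2 * Real.pi * v * -ξ) * I) • ((K v : ℝ) : ℂ)) volume
    rw [← h]
    refine integral_congr_ae (Eventually.of_forall fun v => ?_)
    simp only [hK.2.1 v]
    congr 2
    push_cast
    ring
  -- average the two
  have havg : 𝓕 (fun u : ℝ => (K u : ℂ)) ξ =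
      ∫ v : ℝ, (((K v * Real.cos (v * (2 * Real.pi * ξ)) : ℝ)) : ℂ) := by
    have hpt : ∀ v : ℝ, Complex.exp (↑(-2 * Real.pi * v * ξ) * I) • ((K v : ℝ) : ℂ) +
        Complex.exp (↑(-2 * Real.pi * v * -ξ) * I) • ((K v : ℝ) : ℂ) =
        (2 : ℂ) * (((K v * Real.cos (v * (2 * Real.pi * ξ)) : ℝ)) : ℂ) := by
      intro v
      simp only [smul_eq_mul]
      have hc := Complex.two_cos ((v : ℂ) * (2 * Real.pi * ξ))
      push_cast
      rw [show (-2 * ↑Real.pi * ↑v * ↑ξ : ℂ) * I = -(↑v * (2 * ↑Real.pi * ↑ξ)) * I by ring]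
      rw [show (-2 * ↑Real.pi * ↑v * -↑ξ : ℂ) * I = (↑v * (2 * ↑Real.pi * ↑ξ)) * I by ring]
      linear_combination (↑(K v) : ℂ) * hc.symm
    have hsum : 𝓕 (fun u : ℝ => (K u : ℂ)) ξ + 𝓕 (fun u : ℝ => (K u : ℂ)) (-ξ) =
        2 * ∫ v : ℝ, (((K v * Real.cos (v * (2 * Real.pi * ξ)) : ℝ)) : ℂ) := by
      rw [Real.fourier_real_eq_integral_exp_smul, Real.fourier_real_eq_integral_exp_smul,
        ← integral_add (hint ξ) (hint (-ξ)), integral_congr_ae (Eventually.of_forall hpt),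
        integral_const_mul]
    rw [← hsym, ← two_mul] at hsum
    exact mul_left_cancel₀ two_ne_zero hsum
  rw [havg, integral_complex_ofReal]
  congr 1
  -- `∫_ℝ K cos = 2 ∫_{(0,∞)} K cos` by evenness
  have hev : ∀ x : ℝ, K x * Real.cos (x * (2 * Real.pi * ξ)) =
      (fun y : ℝ => K y * Real.cos (y * (2 * Real.pi * ξ))) |x| := by
    intro x
    by_cases hx : 0 ≤ x
    · simp only [abs_of_nonneg hx]
    · simp only [abs_of_neg (lt_of_not_ge hx), hK.2.1 x, neg_mul, Real.cos_neg]
  rw [show (fun v : ℝ => K v * Real.cos (v * (2 * Real.pi * ξ))) =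
      fun v : ℝ => (fun y : ℝ => K y * Real.cos (y * (2 * Real.pi * ξ))) |v| from funext hev,
    integral_comp_abs (f := fun y : ℝ => K y * Real.cos (y * (2 * Real.pi * ξ)))]
  simp [ciL]

/-- `𝓕K` is integrable (it is `L(2π·)`, `|L| ≤ (1+|v|)^{-4}`). [cite: ConreyIwaniec2002, §6 (6.3)] -/
theorem integrable_fourier_kernel : Integrable (𝓕 (fun u : ℝ => (K u : ℂ))) := by
  have heq : 𝓕 (fun u : ℝ => (K u : ℂ)) = fun ξ : ℝ => ((ciL K (2 * Real.pi * ξ) : ℝ) : ℂ) :=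
    funext (fourier_kernel_eq hK)
  rw [heq]
  have hcont : Continuous fun ξ : ℝ => ((ciL K (2 * Real.pi * ξ) : ℝ) : ℂ) :=
    continuous_ofReal.comp (hK.2.2.2.2.1.continuous.comp (continuous_const.mul continuous_id))
  have hdom : Integrable (fun ξ : ℝ => (1 + ‖ξ‖) ^ (-(4 : ℝ))) :=
    integrable_one_add_norm (by simp)
  refine Integrable.mono' hdom hcont.aestronglyMeasurable (Eventually.of_forall fun ξ => ?_)
  rw [Complex.norm_real, Real.norm_eq_abs]
  refine (abs_ciL_le hK _).trans ?_
  rw [Real.norm_eq_abs, Real.rpow_neg (by positivity), show (4:ℝ) = ((4:ℕ):ℝ) by norm_num,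
    Real.rpow_natCast]
  apply inv_anti₀ (by positivity)
  apply pow_le_pow_left₀ (by positivity)
  rw [abs_mul, abs_of_pos (by positivity : (0:ℝ) < 2 * Real.pi)]
  have : |ξ| ≤ 2 * Real.pi * |ξ| := by
    have hξ := abs_nonneg ξ
    nlinarith [Real.pi_gt_three]
  linarith

/-- **`∫₀^∞ L(v) dv = 0`**: Fourier inversion for `K` at `0` gives `∫_ℝ 𝓕K = K(0) = 0`, and
`𝓕K(ξ) = L(2πξ)` with `L` even. [cite: ConreyIwaniec2002, §6 (before (6.33))] -/
theorem integral_ciL_eq_zero : ∫ v in Ioi (0:ℝ), ciL K v = 0 := by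
  have hKc : Continuous K := hK.1
  have hKi : Integrable (fun u : ℝ => (K u : ℂ)) :=
    (hKc.integrable_of_hasCompactSupport hK.2.2.2.1).ofReal
  have hinv := hKi.fourierInv_fourier_eq (integrable_fourier_kernel hK)
    (continuous_ofReal.comp hKc).continuousAt (v := 0)
  rw [hK.2.2.1, Complex.ofReal_zero, Real.fourierInv_eq'] at hinv
  simp only [inner_zero_right, mul_zero, Complex.ofReal_zero, zero_mul, Complex.exp_zero,
    one_smul] at hinv
  have heq : 𝓕 (fun u : ℝ => (K u : ℂ)) = fun ξ : ℝ => ((ciL K (2 * Real.pi * ξ) : ℝ) : ℂ) :=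
    funext (fourier_kernel_eq hK)
  rw [heq, integral_complex_ofReal, Complex.ofReal_eq_zero] at hinv
  -- `∫ L(2πξ) dξ = (2π)⁻¹ ∫ L`, and `∫_ℝ L = 2 ∫_{(0,∞)} L`
  rw [Measure.integral_comp_mul_left (fun v => ciL K v) (2 * Real.pi)] at hinv
  have h2pi : |(2 * Real.pi)⁻¹| ≠ 0 := by positivity
  rw [smul_eq_mul, mul_eq_zero] at hinv
  rcases hinv with h | h
  · exact absurd h h2pi
  have hev : (fun v : ℝ => ciL K v) = fun v : ℝ => (fun y => ciL K y) |v| := by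
    funext v
    by_cases hv : 0 ≤ v
    · simp only [abs_of_nonneg hv]
    · simp only [abs_of_neg (lt_of_not_ge hv), ciL_even]
  rw [hev, integral_comp_abs (f := fun y => ciL K y)] at h
  simpa using h

/-- **`M(1) = 0`** ("`M(1) = ∫₀^∞ L(v)dv = 2πK(0) = 0` by our assumption (6.1)").
[cite: ConreyIwaniec2002, §6 (before (6.33))] -/
theorem mellin_ciL_one : mellin (fun v : ℝ => ((ciL K v : ℝ) : ℂ)) 1 = 0 := by
  unfold mellin
  simp only [sub_self, Complex.cpow_zero, one_smul]
  rw [integral_complex_ofReal, integral_ciL_eq_zero hK, Complex.ofReal_zero]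

/-- **`M` is holomorphic on `0 < Re s < 4`.** [cite: ConreyIwaniec2002, §6 (6.32)] -/
theorem differentiableAt_mellin_ciL {s : ℂ} (h0 : 0 < s.re) (h4 : s.re < 4) :
    DifferentiableAt ℂ (mellin fun v : ℝ => ((ciL K v : ℝ) : ℂ)) s := by
  have hcont : Continuous fun v : ℝ => ((ciL K v : ℝ) : ℂ) :=
    continuous_ofReal.comp hK.2.2.2.2.1.continuous
  refine mellin_differentiableAt_of_isBigO_rpow (a := 4) (b := 0)
    (hcont.locallyIntegrable.locallyIntegrableOn (Ioi 0)) ?_ h4 ?_ h0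
  · refine Asymptotics.IsBigO.of_bound 1 ?_
    filter_upwards [eventually_gt_atTop 0] with v hv
    rw [Complex.norm_real, Real.norm_eq_abs, one_mul, Real.norm_of_nonneg (Real.rpow_nonneg hv.le _)]
    refine (abs_ciL_le hK v).trans ?_
    rw [abs_of_pos hv, Real.rpow_neg hv.le, show (4:ℝ) = ((4:ℕ):ℝ) by norm_num, Real.rpow_natCast]
    exact inv_anti₀ (by positivity) (pow_le_pow_left₀ hv.le (by linarith) 4)
  · refine Asymptotics.IsBigO.of_bound 1 ?_
    refine eventually_nhdsWithin_of_forall fun v hv => ?_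
    have hv0 : (0:ℝ) < v := hv
    rw [Complex.norm_real, Real.norm_eq_abs, neg_zero, Real.rpow_zero, norm_one, one_mul]
    refine (abs_ciL_le hK v).trans (inv_le_one_of_one_le₀ (one_le_pow₀ (by
      linarith [abs_nonneg v])))

/-- Continuity of `t ↦ M(σ + it)` for `0 < σ < 4`. [cite: ConreyIwaniec2002, §6 (6.32)] -/
theorem continuous_mellin_ciL_vertical {σ : ℝ} (h0 : 0 < σ) (h4 : σ < 4) :
    Continuous fun t : ℝ => mellin (fun v : ℝ => ((ciL K v : ℝ) : ℂ)) (σ + t * I) := by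
  have hline : Continuous fun t : ℝ => (σ : ℂ) + t * I := by fun_prop
  refine continuous_iff_continuousAt.mpr fun t => ?_
  have hd := differentiableAt_mellin_ciL hK (s := σ + t * I) (by simp; exact h0) (by simp; exact h4)
  exact ContinuousAt.comp (g := mellin fun v : ℝ => ((ciL K v : ℝ) : ℂ))
    (f := fun t : ℝ => (σ : ℂ) + t * I) hd.continuousAt hline.continuousAt

/-- Vertical integrability of `M` on `Re s = σ ∈ (0, 3/2]`: `‖M(σ+it)‖ ≤ 3/(σ² + t²)`.
[cite: ConreyIwaniec2002, §6 (6.32)] -/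
theorem verticalIntegrable_mellin_ciL {σ : ℝ} (h0 : 0 < σ) (h2 : σ ≤ 3 / 2) :
    Complex.VerticalIntegrable (mellin fun v : ℝ => ((ciL K v : ℝ) : ℂ)) σ := by
  unfold Complex.VerticalIntegrable
  have hdom : Integrable fun t : ℝ => 3 * (σ⁻¹) ^ 2 * (1 + (σ⁻¹ * t) ^ 2)⁻¹ := by
    have := (integrable_inv_one_add_sq.comp_mul_left' (ne_of_gt (inv_pos.mpr h0)))
    exact (this.const_mul (3 * (σ⁻¹) ^ 2))
  refine Integrable.mono' hdom (continuous_mellin_ciL_vertical hK h0 (by linarith)).aestronglyMeasurable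
    (Eventually.of_forall fun t => ?_)
  have hb := norm_mellin_ciL_le_two hK (s := σ + t * I) (by simp; exact h0) (by simp; exact h2)
  refine hb.trans ?_
  have hs : ‖(σ : ℂ) + t * I‖ ^ 2 = σ ^ 2 + t ^ 2 := by
    rw [Complex.sq_norm, Complex.normSq_apply]; simp; ring
  have hs1 : σ ^ 2 + t ^ 2 ≤ ‖(σ : ℂ) + t * I + 1‖ ^ 2 := by
    rw [Complex.sq_norm, Complex.normSq_apply]; simp; nlinarith
  have hσt : 0 < σ ^ 2 + t ^ 2 := by positivity
  have hn0 : 0 < ‖(σ : ℂ) + t * I‖ := by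
    rw [← sq_lt_sq₀ (le_refl 0) (norm_nonneg _)] ; rw [hs]; simpa using hσt
  have hn1 : Real.sqrt (σ ^ 2 + t ^ 2) ≤ ‖(σ : ℂ) + t * I + 1‖ := by
    rw [Real.sqrt_le_left (norm_nonneg _)]; exact hs1
  have hsqrt : Real.sqrt (σ ^ 2 + t ^ 2) = ‖(σ : ℂ) + t * I‖ := by
    rw [← hs, Real.sqrt_sq (norm_nonneg _)]
  calc 3 / (‖(σ : ℂ) + t * I‖ * ‖(σ : ℂ) + t * I + 1‖)
      ≤ 3 / (‖(σ : ℂ) + t * I‖ * ‖(σ : ℂ) + t * I‖) := by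
        gcongr
        rw [← hsqrt]; exact hn1
    _ = 3 / (σ ^ 2 + t ^ 2) := by rw [← sq, hs]
    _ = 3 * (σ⁻¹) ^ 2 * (1 + (σ⁻¹ * t) ^ 2)⁻¹ := by
        field_simp

/-- **Mellin inversion for `L`**: `L(x) = (1/2π)∫ x^{-(c+it)} M(c+it) dt` for `x > 0`,
`0 < c ≤ 3/2`. [cite: Titchmarsh1948, §1.29] -/
theorem ciL_eq_mellinInv {c : ℝ} (h0 : 0 < c) (h2 : c ≤ 3 / 2) {x : ℝ} (hx : 0 < x) :
    ((ciL K x : ℝ) : ℂ) = mellinInv c (mellin fun v : ℝ => ((ciL K v : ℝ) : ℂ)) x := by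
  have hcont : Continuous fun v : ℝ => ((ciL K v : ℝ) : ℂ) :=
    continuous_ofReal.comp hK.2.2.2.2.1.continuous
  have hconv : MellinConvergent (fun v : ℝ => ((ciL K v : ℝ) : ℂ)) c :=
    mellinConvergent_of_quartic (A := 1) hcont.continuousOn
      (fun v hv => by simpa using norm_iteratedDeriv_ciL_le hK (j := 0) (by norm_num) hv)
      (by simp; exact h0) (by simp; linarith)
  exact (mellinInv_mellin_eq c _ hx hconv (verticalIntegrable_mellin_ciL hK h0 h2)
    hcont.continuousAt).symm

end Kernel2

end KernelMellin

end ConreyIwaniec2002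

end Literature.NumberTheory.LFunctions

end
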